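import Summits.BirchSwinnertonDyer.BirchSwinnertonDyer.Theses.KatoDescentPotSupersingular
import Summits.BirchSwinnertonDyer.BirchSwinnertonDyer.Theorems.KatoDescentPotSupersingularWildJetchevBoundAtPOfStubs
import HarnessLib

/-!
**ARCHIVED v2** (registered sha f44935873f05 @ 6bdfe1cb47dc, 10:16Z; superseded by v3 = k9-c4 g8 v2.1 cut, 11:0xZ) — namespace `.BirthV2`; its S2p `stub_divisibilityAtP` is proved in v3 from finer stubs; p518161 §3 stays the record.

# BC3 SKELETON v2 — crux `WildJetchevBoundAtP` (item stmt-BirchSwinnertonDyer-19941; route K9 =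
# `Theses/KatoDescentPotSupersingular.lean` rev 21, rank 6; planner bsd-potss-plan g22, 2026-08-27)

v2 RE-CUT after bsd-potss-k9-c4 g8 (p518161 `Theorems/KatoDescentPotSupersingularWildJetchevBoundAtPOfStubs.lean`,
p518685 `…WildJetchevBoundAtPSkeletonRekey.lean`): the crux (`q = p` Heegner-index bound at the ADDITIVE prime,
`ord_p #Ш(W/K)[p^∞] + 2·ord_p c_p(W) ≤ 2·ord_p [W(K) : ℤP]`) is, BY NAME, the composition of FOUR displayed
statements (k9-c4 g8 §3 `wildJetchevBoundAtP_of_structureIrred_of_divisibilityAtP_of_gaussianSupplement`):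

* `stub_structureIrred` (S1, size XL; SHARED — byte-identical to the stub of the same name registered on crux
  20165 `JetchevIrreducibleReadingByName`, `Cruxes/JetchevIrreducibleReadingByName/Lines/birth.lean` v4): the
  Kolyvagin–McCallum STRUCTURE half under IRREDUCIBLE `E[p]`, frame currency, conductor level, `d_K ∉ {−3, −4}`,
  no reduction-type binder at `p` (Matar–Nekovář 2019 Thm. 0.7 + §0.11; McCallum 1991 Cor. 5.6). ONE proof closes
  it on both items (land it `--supports` each). WHY IT MIGHT FAIL: F1 (Kolyvagin 1991 LNM 1479 Thm. 1 primary
  unread in the index reading; needs `E(K)[p] = 0`, automatic here).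
* `stub_divisibilityAtP` (S2p, size XL, conjecture-grade; the ONLY 19941-specific content): under the crux's row
  binders verbatim (non-CM, `r_an = 0`, additive potentially good at odd `p`, `E[p]` irreducible, `p`-adic tower not
  onto, a lattice-optimal datum of conductor level with `p ∤ c`), at every Heegner field with `d_K ∉ {−3, −4}` and
  every frame whose conductor-1 derived point has infinite order: GLOBAL `p^s`-DIVISIBILITY of every derived Heegner
  point at every depth `s ≤ ord_p c_p(W)` — the `q = p` share of Jetchev's Conjecture 1.3 (`m_∞ = ord_p ∏ c_q`),
  outside Jetchev 2008 (Hypothesis (∗) has `p ∤ N`; Lemma 4.3 compares conditions only at `v ∤ p`). Content at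
  `p = 3`, Kodaira IV / IV*, `c_3 = 3` (depth 1); evidence plan g19 (58 «B» rows, BSD-consistent). WHY IT MIGHT
  FAIL: at additive `v ∣ 3` the Kummer image `E(K_v)/3^m` is not `Φ_v`-sized, so the Tamagawa factor need not force
  depth — one B row with `m_∞ = 0 < ord_3 c_3` kills S2p without contradicting BSD. [Jetchev2008 Conj. 1.3, Thm. 1.4,
  §4; McCallumLMS1991 §5]
* `stub_publishedInputsHeegner` (cite): the route's HELD conjunction `PublishedInputsHeegner` (item 19914: Gross–Zagier,
  Kolyvagin, BFH/MM non-vanishing, modularity) BY NAME — as on 20165.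
* `stub_gaussianSupplement` (the crux body AT `d_K = −4`, displayed by k9-c4 g8 as `h4`): the crux's binders do not
  exclude the Gaussian field, S1's print (MN19 Thm. 0.3/0.7: `D_K ≠ −3, −4`) does. For the K9 ROUTE this case is
  VACUOUS (p = 3 is inert in ℚ(i), so ℚ(i) is never Heegner for a level divisible by 3); for `p ≡ 1 (mod 4)` it has
  content and is expected from S1's method with `u_K = 2` a `p`-adic unit (GrossLMS1991 §3) — OR it disappears when
  the binder `NumberField.discr K ≠ -4` is added to the crux at the next serialised K9 edit (then §2 of p518161 is the
  by-name reduction and this stub is dropped: v3). WHY IT MIGHT FAIL: only through S1/S2p at the Gaussian field.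
`WildJetchevBoundAtP_of` is k9-c4 g8's §3 theorem verbatim. Four `sorry`s, all in stubs. Supersedes v1 (g21,
sha fa288a46e054: S1′ `stub_structure_depth_indexForm_d3` / S2′ `stub_derivedPoint_divisible_at_additive_p`, whose
`d_K ≠ −4` restrictions p518685 reduces to S1 / S2p + print; v1 archived as `Lines/v1_indexcurrency_g21.lean`).
-/

noncomputable section

open scoped Classical

open WeierstrassCurve Literature.NumberTheory.EllipticCurves
  Literature.NumberTheory.EllipticCurves.ModularForms
  Literature.NumberTheory.EllipticCurves.Rank1Residual
  Summit.BirchSwinnertonDyer.Rank1Residual Summit.BirchSwinnertonDyer.Rank1Residual.X11b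
open Summit.BirchSwinnertonDyer.BirchSwinnertonDyer

namespace Summit.BirchSwinnertonDyer.BirchSwinnertonDyer.Cruxes.WildJetchevBoundAtP.BirthV2

/-- Statement of `stub_structureIrred` (S1; SHARED with crux 20165's registered stub of the same name, byte-identical):
Kolyvagin's structure theorem, UPPER half, under IRREDUCIBILITY of `E[p]`, no reduction-type binder at `p`
(McCallum currency): `ord_p #Ш(E/K)[p^∞] + 2t ≤ 2M₀` (`p^{M₀} ∥ y_K` in `E(K)`) when every derived Heegner point
is `p^s`-divisible at every depth `s ≤ t`. [MatarNekovar2019 Thm. 0.7 + §0.11; McCallumLMS1991 §5 Cor. 5.6] -/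
abbrev Sig.stub_structureIrred : Prop :=
  ∀ (W : WeierstrassCurve ℚ) [W.IsElliptic] [W.IsGloballyMinimal] [NeZero (W.conductorNorm ℤ)],
    ¬ W.HasCM →
    ∀ (K : Type) [Field K] [NumberField K], IsImaginaryQuadratic K →
    NumberField.discr K ≠ -3 → NumberField.discr K ≠ -4 →
    SatisfiesHeegnerHypothesis (W.conductorNorm ℤ) K →
    ∀ (p : ℕ) [Fact p.Prime], p ≠ 2 → W.HasIrreducibleModPGaloisRep p →
    ∀ (Dt : ModularParametrizationData W (W.conductorNorm ℤ)) (β : ℤ) (ι : K →+* ℂ)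
      (d₁ : KolyvaginHeegnerData Dt β ι 1) (P : (W.baseChange K).toAffine.Point),
      d₁.toGeomPoints d₁.derivedPoint = toGeomPoints (W.baseChange K) P →
      ¬ IsOfFinAddOrder P →
    ∀ (M₀ : ℕ),
      (∃ Q : (W.baseChange K).toAffine.Point, ((p ^ M₀ : ℕ) : ℤ) • Q = P) →
      (¬ ∃ Q : (W.baseChange K).toAffine.Point, ((p ^ (M₀ + 1) : ℕ) : ℤ) • Q = P) →
    ∀ (t : ℕ),
      (∀ (s : ℕ), s ≤ t → ∀ (n : ℕ) (d : KolyvaginHeegnerData Dt β ι n), Squarefree n →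
        (∀ ℓ ∈ n.primeFactors, Zhang2014.IsKolyvaginPrime (W.conductorNorm ℤ) W K p ℓ ∧
          s ≤ Zhang2014.kolyvaginIndex W p ℓ) →
        ∃ Q : (W.baseChange (ringClassField K ι n)).toAffine.Point,
          ((p ^ s : ℕ) : ℤ) • Q = d.derivedPoint) →
    padicValNat p (Nat.card (AddCommGroup.primaryComponent (W.baseChange K).sha p)) + 2 * t ≤ 2 * M₀

/-- Statement of `stub_divisibilityAtP` (S2p): at-`p` global divisibility of the derived Heegner points to depth
`ord_p c_p(W)` at CONDUCTOR level, all row binders of the crux kept, `d_K ∉ {−3, −4}` (k9-c4 g8's `hDp` verbatim).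
[Jetchev2008 Conj. 1.3, Thm. 1.4, §4; McCallumLMS1991 §5] -/
abbrev Sig.stub_divisibilityAtP : Prop :=
  ∀ (W : WeierstrassCurve ℚ) [W.IsElliptic] [W.IsGloballyMinimal] [NeZero (W.conductorNorm ℤ)],
    ¬ W.HasCM →
    ∀ (K : Type) [Field K] [NumberField K], IsImaginaryQuadratic K →
    NumberField.discr K ≠ -3 → NumberField.discr K ≠ -4 →
    SatisfiesHeegnerHypothesis (W.conductorNorm ℤ) K →
    ∀ (p : ℕ) [Fact p.Prime], p ≠ 2 → W.analyticRank = 0 → Addv W p → 0 ≤ padicValRat p W.j →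
    W.HasIrreducibleModPGaloisRep p → ¬ (∀ n : ℕ, W.HasSurjectiveModNGaloisRep (p ^ n : ℕ)) →
    (∃ Dt : ModularParametrizationData W (W.conductorNorm ℤ),
      (∀ z ∈ Dt.L.lattice, ∃ w ∈ periodLattice Dt.f, z = (Dt.c : ℂ) * w) ∧ ¬ (p : ℤ) ∣ Dt.c) →
    ∀ (Dt : ModularParametrizationData W (W.conductorNorm ℤ)) (β : ℤ) (ι : K →+* ℂ)
      (d₁ : KolyvaginHeegnerData Dt β ι 1), ¬ IsOfFinAddOrder d₁.derivedPoint →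
    ∀ (s : ℕ), s ≤ padicValNat p ((W.baseChange ℚ_[p]).localTamagawaNumber ℤ_[p]) →
    ∀ (n : ℕ) (d : KolyvaginHeegnerData Dt β ι n), Squarefree n →
      (∀ ℓ ∈ n.primeFactors, Zhang2014.IsKolyvaginPrime (W.conductorNorm ℤ) W K p ℓ ∧
        s ≤ Zhang2014.kolyvaginIndex W p ℓ) →
      ∃ Q : (W.baseChange (ringClassField K ι n)).toAffine.Point,
        ((p ^ s : ℕ) : ℤ) • Q = d.derivedPoint

/-- Statement of `stub_publishedInputsHeegner` (cite): the K9 route's HELD conjunction `PublishedInputsHeegner`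
(item 19914) BY NAME. -/
abbrev Sig.stub_publishedInputsHeegner : Prop := Theses.KatoDescentPotSupersingular.PublishedInputsHeegner

/-- Statement of `stub_gaussianSupplement` (the crux body at the Gaussian field `d_K = −4`, k9-c4 g8's `h4` verbatim;
vacuous for the K9 route at `p = 3`). [GrossLMS1991 §3 (u_K); MatarNekovar2019 Thm. 0.7] -/
abbrev Sig.stub_gaussianSupplement : Prop :=
  ∀ (N : ℕ) [NeZero N] (W : WeierstrassCurve ℚ) [W.IsElliptic] [W.IsGloballyMinimal]
    (K : Type) [Field K] [NumberField K],
    IsImaginaryQuadratic K → NumberField.discr K = -4 → SatisfiesHeegnerHypothesis N K →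
    ∀ (p : ℕ) [Fact p.Prime], p ≠ 2 → W.analyticRank = 0 → Addv W p → 0 ≤ padicValRat p W.j →
    ¬ W.HasCM → W.HasIrreducibleModPGaloisRep p → ¬ (∀ n : ℕ, W.HasSurjectiveModNGaloisRep (p ^ n : ℕ)) →
    (∃ Dt : ModularParametrizationData W N,
      (∀ z ∈ Dt.L.lattice, ∃ w ∈ periodLattice Dt.f, z = (Dt.c : ℂ) * w) ∧ ¬ (p : ℤ) ∣ Dt.c) →
    ∀ {P : (W.baseChange K).toAffine.Point}, IsHeegnerPoint N W K P → ¬ IsOfFinAddOrder P → p ∣ N →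
    padicValNat p (Nat.card (AddCommGroup.primaryComponent (W.baseChange K).sha p)) +
        2 * padicValNat p ((W.baseChange ℚ_[p]).localTamagawaNumber ℤ_[p]) ≤
      2 * padicValNat p (AddSubgroup.zmultiples P).index

/-- S1 — registered stub (shared with 20165). -/
theorem stub_structureIrred : Sig.stub_structureIrred := by
  sorry

/-- S2p — registered stub (hardest; the 19941-specific content). -/
theorem stub_divisibilityAtP : Sig.stub_divisibilityAtP := by
  sorry

/-- cite — registered stub (held alias 19914 by name). -/
theorem stub_publishedInputsHeegner : Sig.stub_publishedInputsHeegner := by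
  sorry

/-- d_K = −4 supplement — registered stub. -/
theorem stub_gaussianSupplement : Sig.stub_gaussianSupplement := by
  sorry

/-- **The crux from the four stubs**, concluding the K9 route decl BY NAME — k9-c4 g8's §3 theorem
`WildJetchevBoundAtPOfStubs.wildJetchevBoundAtP_of_structureIrred_of_divisibilityAtP_of_gaussianSupplement` (p518161). -/
theorem WildJetchevBoundAtP_of (hS : Sig.stub_structureIrred) (hDp : Sig.stub_divisibilityAtP)
    (hH : Sig.stub_publishedInputsHeegner) (h4 : Sig.stub_gaussianSupplement) :
    Summit.BirchSwinnertonDyer.BirchSwinnertonDyer.Theses.KatoDescentPotSupersingular.WildJetchevBoundAtP :=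
  Theorems.WildJetchevBoundAtPOfStubs.wildJetchevBoundAtP_of_structureIrred_of_divisibilityAtP_of_gaussianSupplement
    hS hDp hH h4

/-- Composition over the registered stubs. -/
theorem wildJetchevBoundAtP_of_stubs :
    Summit.BirchSwinnertonDyer.BirchSwinnertonDyer.Theses.KatoDescentPotSupersingular.WildJetchevBoundAtP :=
  WildJetchevBoundAtP_of stub_structureIrred stub_divisibilityAtP stub_publishedInputsHeegner stub_gaussianSupplement

end Summit.BirchSwinnertonDyer.BirchSwinnertonDyer.Cruxes.WildJetchevBoundAtP.BirthV2

end
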